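import Literature.LinearAlgebra.QuadraticForm.MaslovIndexQuadraticSpaceChain
import HarnessLib

/-!
# The dimension of T. Thomas' Maslov quadratic space for `n = 3` ([Thomas2006, Corollary (eq:dim)])

Topic `LinearAlgebra/QuadraticForm`; namespace `Literature.LinearAlgebra.QuadraticForm`. KERNEL mathematics only
(theorems; no definition, no named fact, no `axiom`, no `sorry`).

[Thomas2006, §2.2.3 Proposition 3 and Corollary, eq. (dim)]: for Lagrangians `l₁, …, l_n` of a symplectic space `V`,
"`ker q = im ∂`" and
`dim T_{1,…,n} = (n − 2)·(dim V)/2 − Σ_{i ∈ ℤ/nℤ} dim(l_i ∩ l_{i+1}) + 2·dim ⋂_i l_i`,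
where `T_{1,…,n} = K_{1,…,n} / ker q`. This file proves the case `n = 3` — the case of the Maslov index of a triple,
where by [Thomas2006, Prop. 11] `T_{1,2,3}` is the quadratic space of Kashiwara's form and the number
`dim T_{1,2,3} = dim V / 2 − dim(l₁∩l₂) − dim(l₂∩l₃) − dim(l₃∩l₁) + 2·dim(l₁∩l₂∩l₃)` is the dimension of the
non-degenerate Leray invariant of [Rao1993, §2.4, Thm. 2.11] (there `dim X₄ / 2`, with
`dim X₄ = 2n − 2Σ dim(Lᵢ∩Lⱼ) + 4 dim(L₁∩L₂∩L₃)` from the proof of Thm. 2.11) — in the tree's language: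
the rank `dim K − dim rad(Q)` of `polygonForm B ![l₀, l₁, l₂]` (`MaslovIndexQuadraticSpace.lean`), whose radical is
Mathlib's `QuadraticMap.radical`.

Proof (direct, for `n = 3`; [Thomas2006] proves Prop. 3 for all `n` by a diagram chase which is not followed here):
on `K = K(l₀, l₁, l₂)` one has `q(v, w) = B(v₂, w₁)` (`polygonBilin_three_of_mem`, from `Σ v_i = 0` and `l₀`
isotropic); the coordinate map `π₂ : v ↦ v₂` has kernel `≅ l₀ ∩ l₁` and image `l₂ ∩ (l₀ + l₁)`, whence
`dim K = dim V/2 + dim(l₀∩l₁∩l₂)` (`finrank_polygonSpace_three`); `w ∈ rad(Q)` iff `w₂ ∈ (l₁ ∩ (l₀ + l₂))^⊥ =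
l₁ + (l₀ ∩ l₂)` (`mem_radical_polygonForm_three_iff`), so `π₂(rad Q) = (l₁∩l₂) + (l₀∩l₂)` and
`dim rad(Q) + dim(l₀∩l₁∩l₂) = dim(l₀∩l₁) + dim(l₁∩l₂) + dim(l₀∩l₂)` (`finrank_radical_polygonForm_three`; this is
`dim im ∂ = Σ dim(l_i∩l_{i+1}) − dim ker ∂` of [Thomas2006, Prop. 3]); together (eq:dim) for `n = 3`
(`finrank_polygonSpace_three_sub_finrank_radical`).

## References

* [Thomas2006] T. Thomas, *The Maslov index as a quadratic space*, Math. Res. Lett. 13 (2006) 985–999, §2.2.3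
  Proposition 3, Corollary (eq:dim); §7 Proposition 11.
* [Rao1993] R. Ranga Rao, *On some explicit formulas in the theory of Weil representation*, Pacific J. Math. 157
  (1993), §2.4 Lemma 2.8, Theorem 2.11 (dimension of the Leray invariant).
* [LionVergne1980] G. Lion, M. Vergne, *The Weil representation, Maslov index and Theta series*, §1.9.3 b)
  ("rank of `Q = 3n − dim(ℓ₁∩ℓ₂) − dim(ℓ₂∩ℓ₃) − dim(ℓ₃∩ℓ₁)`" for Kashiwara's form — the tree's
  `finrank_radical_kashiwaraForm`).
-/

set_option autoImplicit false

noncomputable section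

open QuadraticMap Module

namespace Literature.LinearAlgebra.QuadraticForm

universe u v

variable {K : Type u} [Field K]
variable {V : Type v} [AddCommGroup V] [Module K V]
variable {B : LinearMap.BilinForm K V} (ℓ₀ ℓ₁ ℓ₂ : Submodule K V)

/-! ## The triangle space `K(l₀, l₁, l₂)` and its second coordinate -/

/-- the components and the sum of a member of `K(l₀, l₁, l₂)`. [cite: Thomas2006, §2.2.1 Definition] -/
theorem polygonSpace.mem_three' (v : polygonSpace ![ℓ₀, ℓ₁, ℓ₂]) :
    (v : Fin 3 → V) 0 ∈ ℓ₀ ∧ (v : Fin 3 → V) 1 ∈ ℓ₁ ∧ (v : Fin 3 → V) 2 ∈ ℓ₂ ∧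
      (v : Fin 3 → V) 0 + (v : Fin 3 → V) 1 + (v : Fin 3 → V) 2 = 0 := by
  have h := (mem_polygonSpace_iff _ (v : Fin 3 → V)).1 v.2
  refine ⟨by simpa using h.1 0, by simpa using h.1 1, by simpa using h.1 2, ?_⟩
  rw [← Fin.sum_univ_three]
  exact h.2

/-- `(a, b, c) ∈ K(l₀, l₁, l₂)` for `a ∈ l₀, b ∈ l₁, c ∈ l₂` with `a + b + c = 0`. [cite: Thomas2006, §2.2.1 Definition] -/
theorem vec3_mem_polygonSpace {a b c : V} (ha : a ∈ ℓ₀) (hb : b ∈ ℓ₁) (hc : c ∈ ℓ₂) (h : a + b + c = 0) :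
    ![a, b, c] ∈ polygonSpace ![ℓ₀, ℓ₁, ℓ₂] := by
  rw [mem_polygonSpace_iff]
  refine ⟨fun i => ?_, ?_⟩
  · fin_cases i
    · simpa using ha
    · simpa using hb
    · simpa using hc
  · rw [Fin.sum_univ_three]
    simpa using h

/-- **`q(v, w) = B(v₂, w₁)` on `K(l₀, l₁, l₂)`** when `l₀` is isotropic (from `q₃(v, w) = B(v₁ + v₂, w₀) + B(v₂, w₁)`
and `v₁ + v₂ = −v₀`). [cite: Thomas2006, §2.2.2 Remark 2 and §2.3] -/
theorem polygonBilin_three_of_mem (h₀ : ∀ x ∈ ℓ₀, ∀ y ∈ ℓ₀, B x y = 0) (v w : polygonSpace ![ℓ₀, ℓ₁, ℓ₂]) :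
    polygonBilin B 3 (v : Fin 3 → V) (w : Fin 3 → V) = B ((v : Fin 3 → V) 2) ((w : Fin 3 → V) 1) := by
  obtain ⟨hv0, -, -, hvs⟩ := polygonSpace.mem_three' ℓ₀ ℓ₁ ℓ₂ v
  obtain ⟨hw0, -, -, -⟩ := polygonSpace.mem_three' ℓ₀ ℓ₁ ℓ₂ w
  rw [polygonBilin_three]
  have e : (v : Fin 3 → V) 1 + (v : Fin 3 → V) 2 = -(v : Fin 3 → V) 0 := by
    rw [add_assoc] at hvs
    exact (neg_eq_of_add_eq_zero_right hvs).symm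
  rw [e, map_neg, LinearMap.neg_apply, h₀ _ hv0 _ hw0, neg_zero, zero_add]

/-- the image of the coordinate map `π₂ : K(l₀, l₁, l₂) → V, v ↦ v₂` is `l₂ ∩ (l₀ + l₁)`.
[cite: Thomas2006, §2.2.3 (proof of Prop. 3: "the image of `Σ` consists of elements adding up to zero")] -/
theorem range_proj_two_polygonSpace :
    LinearMap.range ((LinearMap.proj (2 : Fin 3) : (Fin 3 → V) →ₗ[K] V).comp (polygonSpace ![ℓ₀, ℓ₁, ℓ₂]).subtype) =
      ℓ₂ ⊓ (ℓ₀ ⊔ ℓ₁) := by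
  ext y
  rw [LinearMap.mem_range, Submodule.mem_inf, Submodule.mem_sup]
  constructor
  · rintro ⟨v, rfl⟩
    obtain ⟨hv0, hv1, hv2, hvs⟩ := polygonSpace.mem_three' ℓ₀ ℓ₁ ℓ₂ v
    refine ⟨hv2, -(v : Fin 3 → V) 0, ℓ₀.neg_mem hv0, -(v : Fin 3 → V) 1, ℓ₁.neg_mem hv1, ?_⟩
    rw [LinearMap.comp_apply, Submodule.coe_subtype, LinearMap.proj_apply, eq_neg_of_add_eq_zero_right hvs]
    abel
  · rintro ⟨hy, a, ha, b, hb, hab⟩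
    refine ⟨⟨![-a, -b, y], vec3_mem_polygonSpace ℓ₀ ℓ₁ ℓ₂ (ℓ₀.neg_mem ha) (ℓ₁.neg_mem hb) hy ?_⟩, ?_⟩
    · rw [← hab]; abel
    · simp

/-- the kernel of `π₂ : K(l₀, l₁, l₂) → V, v ↦ v₂` is `{(x, −x, 0) : x ∈ l₀ ∩ l₁} ≅ l₀ ∩ l₁`; its dimension.
[cite: Thomas2006, §2.2.3 (eq:dim), case `n = 2`: `K_{1,2} = l₁ ∩ l₂`] -/
theorem finrank_ker_proj_two_polygonSpace [FiniteDimensional K V] :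
    finrank K (LinearMap.ker ((LinearMap.proj (2 : Fin 3) : (Fin 3 → V) →ₗ[K] V).comp
      (polygonSpace ![ℓ₀, ℓ₁, ℓ₂]).subtype)) = finrank K ↥(ℓ₀ ⊓ ℓ₁) := by
  set π : polygonSpace ![ℓ₀, ℓ₁, ℓ₂] →ₗ[K] V :=
    ((LinearMap.proj (2 : Fin 3) : (Fin 3 → V) →ₗ[K] V).comp (polygonSpace ![ℓ₀, ℓ₁, ℓ₂]).subtype) with hπ
  have hπa : ∀ v : polygonSpace ![ℓ₀, ℓ₁, ℓ₂], π v = (v : Fin 3 → V) 2 := fun v => rfl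
  -- the coordinate `v ↦ v₀` on `ker π₂`, into `l₀ ∩ l₁`
  have hmem : ∀ v : LinearMap.ker π, ((v : polygonSpace ![ℓ₀, ℓ₁, ℓ₂]) : Fin 3 → V) 0 ∈ ℓ₀ ⊓ ℓ₁ := by
    intro v
    obtain ⟨hv0, hv1, -, hvs⟩ := polygonSpace.mem_three' ℓ₀ ℓ₁ ℓ₂ (v : polygonSpace ![ℓ₀, ℓ₁, ℓ₂])
    have h2 : ((v : polygonSpace ![ℓ₀, ℓ₁, ℓ₂]) : Fin 3 → V) 2 = 0 := by
      rw [← hπa]; exact LinearMap.mem_ker.1 v.2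
    rw [h2, add_zero] at hvs
    refine Submodule.mem_inf.2 ⟨hv0, ?_⟩
    rw [eq_neg_of_add_eq_zero_left hvs]
    exact ℓ₁.neg_mem hv1
  let f : LinearMap.ker π →ₗ[K] ↥(ℓ₀ ⊓ ℓ₁) :=
    { toFun := fun v => ⟨((v : polygonSpace ![ℓ₀, ℓ₁, ℓ₂]) : Fin 3 → V) 0, hmem v⟩
      map_add' := fun v w => by ext; simp
      map_smul' := fun c v => by ext; simp }
  have hf : ∀ v : LinearMap.ker π, (f v : V) = ((v : polygonSpace ![ℓ₀, ℓ₁, ℓ₂]) : Fin 3 → V) 0 := fun v => rfl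
  refine (LinearEquiv.ofBijective f ⟨?_, ?_⟩).finrank_eq
  · -- injective
    intro v w hvw
    have e0 := congrArg (fun x : ↥(ℓ₀ ⊓ ℓ₁) => (x : V)) hvw
    simp only [hf] at e0
    obtain ⟨-, -, -, hvs⟩ := polygonSpace.mem_three' ℓ₀ ℓ₁ ℓ₂ (v : polygonSpace ![ℓ₀, ℓ₁, ℓ₂])
    obtain ⟨-, -, -, hws⟩ := polygonSpace.mem_three' ℓ₀ ℓ₁ ℓ₂ (w : polygonSpace ![ℓ₀, ℓ₁, ℓ₂])
    have hv2 : ((v : polygonSpace ![ℓ₀, ℓ₁, ℓ₂]) : Fin 3 → V) 2 = 0 := by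
      rw [← hπa]; exact LinearMap.mem_ker.1 v.2
    have hw2 : ((w : polygonSpace ![ℓ₀, ℓ₁, ℓ₂]) : Fin 3 → V) 2 = 0 := by
      rw [← hπa]; exact LinearMap.mem_ker.1 w.2
    have e1 : ((v : polygonSpace ![ℓ₀, ℓ₁, ℓ₂]) : Fin 3 → V) 1 = ((w : polygonSpace ![ℓ₀, ℓ₁, ℓ₂]) : Fin 3 → V) 1 := by
      rw [hv2, add_zero] at hvs
      rw [hw2, add_zero] at hws
      rw [eq_neg_of_add_eq_zero_right hvs, eq_neg_of_add_eq_zero_right hws, e0]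
    apply Subtype.ext
    apply Subtype.ext
    funext i
    fin_cases i
    · exact e0
    · exact e1
    · exact hv2.trans hw2.symm
  · -- surjective
    intro x
    have hx0 : (x : V) ∈ ℓ₀ := (Submodule.mem_inf.1 x.2).1
    have hx1 : (x : V) ∈ ℓ₁ := (Submodule.mem_inf.1 x.2).2
    have hm : (![(x : V), -(x : V), 0] : Fin 3 → V) ∈ polygonSpace ![ℓ₀, ℓ₁, ℓ₂] :=
      vec3_mem_polygonSpace ℓ₀ ℓ₁ ℓ₂ hx0 (ℓ₁.neg_mem hx1) (Submodule.zero_mem _) (by abel)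
    have hk : (⟨![(x : V), -(x : V), 0], hm⟩ : polygonSpace ![ℓ₀, ℓ₁, ℓ₂]) ∈ LinearMap.ker π := by
      rw [LinearMap.mem_ker, hπa]
      simp
    exact ⟨⟨_, hk⟩, Subtype.ext (by simp [hf])⟩

/-- **`dim K(l₀, l₁, l₂) = dim V / 2 + dim(l₀ ∩ l₁ ∩ l₂)`** for Lagrangians `lᵢ` of a non-degenerate reflexive `B`
(`dim V / 2 = dim l₀`). [cite: Thomas2006, §2.2.3 Proposition 3 (proof) and Corollary (eq:dim)] -/
theorem finrank_polygonSpace_three [FiniteDimensional K V] (hR : B.IsRefl) (hN : B.Nondegenerate)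
    (h₀ : B.orthogonal ℓ₀ = ℓ₀) (h₁ : B.orthogonal ℓ₁ = ℓ₁) (h₂ : B.orthogonal ℓ₂ = ℓ₂) :
    finrank K (polygonSpace ![ℓ₀, ℓ₁, ℓ₂]) = finrank K ℓ₀ + finrank K ↥(ℓ₀ ⊓ ℓ₁ ⊓ ℓ₂) := by
  set π : polygonSpace ![ℓ₀, ℓ₁, ℓ₂] →ₗ[K] V :=
    ((LinearMap.proj (2 : Fin 3) : (Fin 3 → V) →ₗ[K] V).comp (polygonSpace ![ℓ₀, ℓ₁, ℓ₂]).subtype) with hπ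
  have hrk := LinearMap.finrank_range_add_finrank_ker π
  rw [finrank_ker_proj_two_polygonSpace, range_proj_two_polygonSpace] at hrk
  -- dimension bookkeeping
  have e₁ := Submodule.finrank_sup_add_finrank_inf_eq ℓ₂ (ℓ₀ ⊔ ℓ₁)
  have e₂ := Submodule.finrank_sup_add_finrank_inf_eq ℓ₀ ℓ₁
  have e₃ : finrank K ↥(ℓ₂ ⊔ (ℓ₀ ⊔ ℓ₁)) + finrank K ↥(ℓ₀ ⊓ ℓ₁ ⊓ ℓ₂) = finrank K V := by
    have h := LinearMap.BilinForm.finrank_add_finrank_orthogonal hR (ℓ₂ ⊔ (ℓ₀ ⊔ ℓ₁))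
    rw [orthogonal_sup_eq_inf, orthogonal_sup_eq_inf, h₀, h₁, h₂] at h
    rw [LinearMap.BilinForm.orthogonal_top_eq_bot hN, inf_bot_eq, finrank_bot, add_zero] at h
    have hlat : ℓ₂ ⊓ (ℓ₀ ⊓ ℓ₁) = ℓ₀ ⊓ ℓ₁ ⊓ ℓ₂ := by rw [inf_comm]
    rw [hlat] at h
    exact h
  have d₀ := two_mul_finrank_eq_of_orthogonal_eq_self hN h₀
  have d₁ := two_mul_finrank_eq_of_orthogonal_eq_self hN h₁
  have d₂ := two_mul_finrank_eq_of_orthogonal_eq_self hN h₂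
  omega

/-! ## The radical of `Q` on `K(l₀, l₁, l₂)` -/

section Radical

variable [NeZero (2 : K)]

/-- **the kernel of `q` on `K(l₀, l₁, l₂)`**: for `B` symplectic and `lᵢ` Lagrangian, `w ∈ rad(Q)` iff
`w₂ ∈ l₁ + (l₀ ∩ l₂)` (`= (l₁ ∩ (l₀ + l₂))^⊥`, the orthogonal of the image of `v ↦ v₁`).
[cite: Thomas2006, §2.2.3 Proposition 3 (`ker q = im ∂`), case `n = 3`] -/
theorem mem_radical_polygonForm_three_iff [FiniteDimensional K V] (hB : B.IsAlt) (hN : B.Nondegenerate)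
    (h₀ : B.orthogonal ℓ₀ = ℓ₀) (h₁ : B.orthogonal ℓ₁ = ℓ₁) (h₂ : B.orthogonal ℓ₂ = ℓ₂)
    (w : polygonSpace ![ℓ₀, ℓ₁, ℓ₂]) :
    w ∈ (polygonForm B ![ℓ₀, ℓ₁, ℓ₂]).radical ↔ (w : Fin 3 → V) 2 ∈ ℓ₁ ⊔ (ℓ₀ ⊓ ℓ₂) := by
  haveI : Invertible (2 : K) := invertibleOfNonzero (NeZero.ne 2)
  have hR : B.IsRefl := LinearMap.IsAlt.isRefl hB
  have iso0 := isotropic_of_orthogonal_eq_self h₀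
  have iso : ∀ i, ∀ x ∈ (![ℓ₀, ℓ₁, ℓ₂] : Fin 3 → Submodule K V) i,
      ∀ y ∈ (![ℓ₀, ℓ₁, ℓ₂] : Fin 3 → Submodule K V) i, B x y = 0 := by
    intro i
    fin_cases i
    · exact iso0
    · exact isotropic_of_orthogonal_eq_self h₁
    · exact isotropic_of_orthogonal_eq_self h₂
  -- `(l₁ ∩ (l₀ + l₂))^⊥ = l₁ + (l₀ ∩ l₂)`
  have horth : B.orthogonal (ℓ₁ ⊓ (ℓ₀ ⊔ ℓ₂)) = ℓ₁ ⊔ (ℓ₀ ⊓ ℓ₂) := by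
    rw [orthogonal_inf_eq_sup hN hR, orthogonal_sup_eq_inf, h₀, h₁, h₂]
  -- the image of `v ↦ v₁` is `l₁ ∩ (l₀ + l₂)` (the statement `range_proj_two_polygonSpace` for `(l₂, l₀, l₁)`,
  -- transported by hand)
  rw [QuadraticMap.radical_eq_ker_polarBilin, LinearMap.mem_ker, ← horth, LinearMap.BilinForm.mem_orthogonal_iff]
  constructor
  · intro hw y hy
    obtain ⟨hy1, hy02⟩ := Submodule.mem_inf.1 hy
    obtain ⟨a, ha, c, hc, hac⟩ := Submodule.mem_sup.1 hy02
    set v : polygonSpace ![ℓ₀, ℓ₁, ℓ₂] :=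
      ⟨![-a, y, -c], vec3_mem_polygonSpace ℓ₀ ℓ₁ ℓ₂ (ℓ₀.neg_mem ha) hy1 (ℓ₂.neg_mem hc) (by rw [← hac]; abel)⟩
      with hv
    have e := LinearMap.congr_fun hw v
    rw [QuadraticMap.polarBilin_apply_apply, LinearMap.zero_apply, polar_polygonForm_eq_two_mul B _ hB iso,
      polygonBilin_three_of_mem ℓ₀ ℓ₁ ℓ₂ iso0, mul_eq_zero] at e
    have e' : B ((w : Fin 3 → V) 2) y = 0 := by
      rcases e with e | e
      · exact absurd e (NeZero.ne 2)
      · simpa [hv] using e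
    -- `IsOrtho B y (w 2)`
    show B y ((w : Fin 3 → V) 2) = 0
    exact hR _ _ e'
  · intro hw
    refine LinearMap.ext fun v => ?_
    rw [QuadraticMap.polarBilin_apply_apply, LinearMap.zero_apply, polar_polygonForm_eq_two_mul B _ hB iso,
      polygonBilin_three_of_mem ℓ₀ ℓ₁ ℓ₂ iso0]
    obtain ⟨hv0, hv1, hv2, hvs⟩ := polygonSpace.mem_three' ℓ₀ ℓ₁ ℓ₂ v
    have hy : (v : Fin 3 → V) 1 ∈ ℓ₁ ⊓ (ℓ₀ ⊔ ℓ₂) := by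
      refine Submodule.mem_inf.2 ⟨hv1, Submodule.mem_sup.2 ⟨-(v : Fin 3 → V) 0, ℓ₀.neg_mem hv0,
        -(v : Fin 3 → V) 2, ℓ₂.neg_mem hv2, ?_⟩⟩
      rw [add_assoc, add_comm ((v : Fin 3 → V) 1), ← add_assoc] at hvs
      rw [eq_neg_of_add_eq_zero_right hvs]
      abel
    have e : B ((v : Fin 3 → V) 1) ((w : Fin 3 → V) 2) = 0 := hw _ hy
    rw [hR _ _ e, mul_zero]

/-- the image of `rad(Q)` under `π₂ : w ↦ w₂` is `(l₁ ∩ l₂) + (l₀ ∩ l₂)`.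
[cite: Thomas2006, §2.2.3 Proposition 3 (`ker q = im ∂`), case `n = 3`] -/
theorem map_proj_two_radical_polygonForm_three [FiniteDimensional K V] (hB : B.IsAlt) (hN : B.Nondegenerate)
    (h₀ : B.orthogonal ℓ₀ = ℓ₀) (h₁ : B.orthogonal ℓ₁ = ℓ₁) (h₂ : B.orthogonal ℓ₂ = ℓ₂) :
    Submodule.map (((LinearMap.proj (2 : Fin 3) : (Fin 3 → V) →ₗ[K] V).comp (polygonSpace ![ℓ₀, ℓ₁, ℓ₂]).subtype))
      (polygonForm B ![ℓ₀, ℓ₁, ℓ₂]).radical = (ℓ₁ ⊓ ℓ₂) ⊔ (ℓ₀ ⊓ ℓ₂) := by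
  ext y
  rw [Submodule.mem_map, Submodule.mem_sup]
  constructor
  · rintro ⟨w, hw, rfl⟩
    obtain ⟨-, -, hw2, -⟩ := polygonSpace.mem_three' ℓ₀ ℓ₁ ℓ₂ w
    have hw' := (mem_radical_polygonForm_three_iff ℓ₀ ℓ₁ ℓ₂ hB hN h₀ h₁ h₂ w).1 hw
    obtain ⟨b, hb, a, ha, hba⟩ := Submodule.mem_sup.1 hw'
    have hb2 : b ∈ ℓ₂ := by
      have e : b = (w : Fin 3 → V) 2 - a := by rw [← hba]; abel
      rw [e]
      exact ℓ₂.sub_mem hw2 (Submodule.mem_inf.1 ha).2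
    refine ⟨b, Submodule.mem_inf.2 ⟨hb, hb2⟩, a, ha, ?_⟩
    rw [hba]
    rfl
  · rintro ⟨b, hb, a, ha, rfl⟩
    obtain ⟨hb1, hb2⟩ := Submodule.mem_inf.1 hb
    obtain ⟨ha0, ha2⟩ := Submodule.mem_inf.1 ha
    set w : polygonSpace ![ℓ₀, ℓ₁, ℓ₂] :=
      ⟨![-a, -b, b + a], vec3_mem_polygonSpace ℓ₀ ℓ₁ ℓ₂ (ℓ₀.neg_mem ha0) (ℓ₁.neg_mem hb1)
        (ℓ₂.add_mem hb2 ha2) (by abel)⟩ with hw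
    have hw2 : (w : Fin 3 → V) 2 = b + a := by simp [hw]
    refine ⟨w, ?_, hw2⟩
    rw [mem_radical_polygonForm_three_iff ℓ₀ ℓ₁ ℓ₂ hB hN h₀ h₁ h₂ w, hw2]
    exact Submodule.mem_sup.2 ⟨b, hb1, a, ha, rfl⟩

/-- **`dim rad(Q) + dim(l₀∩l₁∩l₂) = dim(l₀∩l₁) + dim(l₁∩l₂) + dim(l₀∩l₂)`** on `K(l₀, l₁, l₂)` (`B` symplectic,
`lᵢ` Lagrangian, `2 ≠ 0`): "`dim ker q = dim im ∂ = Σ dim(l_i ∩ l_{i+1}) − dim ⋂ l_i`".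
[cite: Thomas2006, §2.2.3 Proposition 3 and the proof of Corollary (eq:dim)] -/
theorem finrank_radical_polygonForm_three [FiniteDimensional K V] (hB : B.IsAlt) (hN : B.Nondegenerate)
    (h₀ : B.orthogonal ℓ₀ = ℓ₀) (h₁ : B.orthogonal ℓ₁ = ℓ₁) (h₂ : B.orthogonal ℓ₂ = ℓ₂) :
    finrank K (polygonForm B ![ℓ₀, ℓ₁, ℓ₂]).radical + finrank K ↥(ℓ₀ ⊓ ℓ₁ ⊓ ℓ₂) =
      finrank K ↥(ℓ₀ ⊓ ℓ₁) + finrank K ↥(ℓ₁ ⊓ ℓ₂) + finrank K ↥(ℓ₀ ⊓ ℓ₂) := by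
  set π : polygonSpace ![ℓ₀, ℓ₁, ℓ₂] →ₗ[K] V :=
    ((LinearMap.proj (2 : Fin 3) : (Fin 3 → V) →ₗ[K] V).comp (polygonSpace ![ℓ₀, ℓ₁, ℓ₂]).subtype) with hπ
  set ρ := (polygonForm B ![ℓ₀, ℓ₁, ℓ₂]).radical with hρ
  have hrk := LinearMap.finrank_range_add_finrank_ker (V := ↥ρ) (π.domRestrict ρ)
  -- the image
  rw [LinearMap.range_domRestrict, map_proj_two_radical_polygonForm_three ℓ₀ ℓ₁ ℓ₂ hB hN h₀ h₁ h₂] at hrk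
  -- the kernel: `ker π ≤ rad(Q)`
  have hle : LinearMap.ker π ≤ ρ := by
    intro w hw
    rw [hρ, mem_radical_polygonForm_three_iff ℓ₀ ℓ₁ ℓ₂ hB hN h₀ h₁ h₂ w]
    have e : (w : Fin 3 → V) 2 = 0 := LinearMap.mem_ker.1 hw
    rw [e]
    exact Submodule.zero_mem _
  have hker : finrank K (LinearMap.ker (π.domRestrict ρ)) = finrank K ↥(ℓ₀ ⊓ ℓ₁) := by
    rw [LinearMap.ker_domRestrict, (Submodule.comapSubtypeEquivOfLe hle).finrank_eq]
    exact finrank_ker_proj_two_polygonSpace ℓ₀ ℓ₁ ℓ₂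
  rw [hker] at hrk
  have e₁ := Submodule.finrank_sup_add_finrank_inf_eq (ℓ₁ ⊓ ℓ₂) (ℓ₀ ⊓ ℓ₂)
  have hlat : ℓ₁ ⊓ ℓ₂ ⊓ (ℓ₀ ⊓ ℓ₂) = ℓ₀ ⊓ ℓ₁ ⊓ ℓ₂ := by
    ext x
    simp only [Submodule.mem_inf]
    tauto
  rw [hlat] at e₁
  omega

/-- **[Thomas2006, Corollary (eq:dim)] for `n = 3`**: for `B` symplectic on `V` and Lagrangians `l₀, l₁, l₂`,
`dim T(l₀,l₁,l₂) = dim K − dim rad(Q) = dim V/2 − dim(l₀∩l₁) − dim(l₁∩l₂) − dim(l₂∩l₀) + 2·dim(l₀∩l₁∩l₂)`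
(`dim V / 2 = dim l₀`); this is the dimension of the non-degenerate Leray invariant of the triple
([Rao1993, Thm. 2.11]). [cite: Thomas2006, §2.2.3 Corollary, eq. (dim); Rao1993, §2.4 Theorem 2.11 (proof)] -/
theorem finrank_polygonSpace_three_sub_finrank_radical [FiniteDimensional K V] (hB : B.IsAlt)
    (hN : B.Nondegenerate) (h₀ : B.orthogonal ℓ₀ = ℓ₀) (h₁ : B.orthogonal ℓ₁ = ℓ₁) (h₂ : B.orthogonal ℓ₂ = ℓ₂) :
    (finrank K (polygonSpace ![ℓ₀, ℓ₁, ℓ₂]) : ℤ) - finrank K (polygonForm B ![ℓ₀, ℓ₁, ℓ₂]).radical =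
      finrank K ℓ₀ - finrank K ↥(ℓ₀ ⊓ ℓ₁) - finrank K ↥(ℓ₁ ⊓ ℓ₂) - finrank K ↥(ℓ₀ ⊓ ℓ₂) +
        2 * finrank K ↥(ℓ₀ ⊓ ℓ₁ ⊓ ℓ₂) := by
  have e₁ := finrank_polygonSpace_three ℓ₀ ℓ₁ ℓ₂ (LinearMap.IsAlt.isRefl hB) hN h₀ h₁ h₂
  have e₂ := finrank_radical_polygonForm_three ℓ₀ ℓ₁ ℓ₂ hB hN h₀ h₁ h₂
  omega

/-- additive form of (eq:dim) for `n = 3` (natural numbers):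
`dim K + dim(l₀∩l₁) + dim(l₁∩l₂) + dim(l₀∩l₂) = dim rad(Q) + dim l₀ + 2·dim(l₀∩l₁∩l₂)`.
[cite: Thomas2006, §2.2.3 Corollary, eq. (dim)] -/
theorem finrank_polygonSpace_three_add [FiniteDimensional K V] (hB : B.IsAlt) (hN : B.Nondegenerate)
    (h₀ : B.orthogonal ℓ₀ = ℓ₀) (h₁ : B.orthogonal ℓ₁ = ℓ₁) (h₂ : B.orthogonal ℓ₂ = ℓ₂) :
    finrank K (polygonSpace ![ℓ₀, ℓ₁, ℓ₂]) + finrank K ↥(ℓ₀ ⊓ ℓ₁) + finrank K ↥(ℓ₁ ⊓ ℓ₂) +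
        finrank K ↥(ℓ₀ ⊓ ℓ₂) =
      finrank K (polygonForm B ![ℓ₀, ℓ₁, ℓ₂]).radical + finrank K ℓ₀ + 2 * finrank K ↥(ℓ₀ ⊓ ℓ₁ ⊓ ℓ₂) := by
  have e₁ := finrank_polygonSpace_three ℓ₀ ℓ₁ ℓ₂ (LinearMap.IsAlt.isRefl hB) hN h₀ h₁ h₂
  have e₂ := finrank_radical_polygonForm_three ℓ₀ ℓ₁ ℓ₂ hB hN h₀ h₁ h₂
  omega

/-- **pairwise transverse Lagrangians**: `Q` is non-degenerate on `K(l₀, l₁, l₂)` (`rad(Q) = 0`) and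
`dim K(l₀, l₁, l₂) = dim V / 2` ("if they are pairwise transverse, the `(V, ω)` … `q(L₁, L₂, L₃)` … is nondegenerate
… `dim X = n`"). [cite: Thomas2006, §2.3 (pairwise transverse case); Rao1993, §2.4 Lemma 2.5(b), Cor. 2.6] -/
theorem radical_polygonForm_three_eq_bot_of_isCompl [FiniteDimensional K V] (hB : B.IsAlt) (hN : B.Nondegenerate)
    (h₀ : B.orthogonal ℓ₀ = ℓ₀) (h₁ : B.orthogonal ℓ₁ = ℓ₁) (h₂ : B.orthogonal ℓ₂ = ℓ₂)
    (h₀₁ : ℓ₀ ⊓ ℓ₁ = ⊥) (h₁₂ : ℓ₁ ⊓ ℓ₂ = ⊥) (h₀₂ : ℓ₀ ⊓ ℓ₂ = ⊥) :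
    (polygonForm B ![ℓ₀, ℓ₁, ℓ₂]).radical = ⊥ ∧ finrank K (polygonSpace ![ℓ₀, ℓ₁, ℓ₂]) = finrank K ℓ₀ := by
  have e₁ := finrank_polygonSpace_three ℓ₀ ℓ₁ ℓ₂ (LinearMap.IsAlt.isRefl hB) hN h₀ h₁ h₂
  have e₂ := finrank_radical_polygonForm_three ℓ₀ ℓ₁ ℓ₂ hB hN h₀ h₁ h₂
  have h012 : ℓ₀ ⊓ ℓ₁ ⊓ ℓ₂ = ⊥ := by rw [h₀₁, bot_inf_eq]
  rw [h012, h₀₁, h₁₂, h₀₂, finrank_bot] at e₂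
  rw [h012, finrank_bot, add_zero] at e₁
  refine ⟨?_, e₁⟩
  rw [← Submodule.finrank_eq_zero]
  omega

end Radical

end Literature.LinearAlgebra.QuadraticForm
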